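import Summits.PneNP.PneNP.Theses.PlantedClique

/-!
# Route PlantedClique — `PlantedcliqueIndistinguishableGlue` (stmt-PneNP-8688)

Pure logic: the clique-family low-degree prediction at the window sequence plus the norm-one calculation give the
indistinguishability crux (`PlantedcliqueLowDegreePrediction → PlantedcliqueLowDegreeNormOne → PlantedcliqueIndistinguishable`).
-/

set_option linter.dupNamespace false -- `Summit.PneNP.PneNP.…`: summit = sub-problem name (D-0017 single-conjunct layout)

namespace Summit.PneNP.PneNP.Theorems

/-- **Support item `PlantedcliqueIndistinguishableGlue` of route PlantedClique (stmt-PneNP-8688)**: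
`PlantedcliqueLowDegreePrediction → PlantedcliqueLowDegreeNormOne → PlantedcliqueIndistinguishable` — feed the norm-one
limit supplied for an admissible `k` into the prediction. [cite: KuniskyWeinBandeira2019, §1 (method)] [folklore] -/
theorem plantedClique_indistinguishableGlue_proof :
    Summit.PneNP.PneNP.Theses.PlantedClique.PlantedcliqueIndistinguishableGlue := by
  unfold Summit.PneNP.PneNP.Theses.PlantedClique.PlantedcliqueIndistinguishableGlue
    Summit.PneNP.PneNP.Theses.PlantedClique.PlantedcliqueLowDegreePrediction
    Summit.PneNP.PneNP.Theses.PlantedClique.PlantedcliqueLowDegreeNormOne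
    Summit.PneNP.PneNP.Theses.PlantedClique.PlantedcliqueIndistinguishable
  intro hP hN k hk
  exact hP k (hN k hk)

end Summit.PneNP.PneNP.Theorems
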